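/-
Copyright (c) 2026 the pub-hodgecm-mathlib formalisation cell (harness21).  Prover seat hodgecm-mathlib-LH7-p08 (g0) (re-dealt to strike line L3 `stub_N6nsDyadic` by director
s1969 (a)), Track A «(D-RAM) FOUR-FRAME» squad, helper lane on h413 = stmt-HodgeConjecture-24833 (count-neutral).  β-BOARD v1 row R8 ∕ (P5) «H `(2ρ,2ρ,2ρ)`», FILE 4e: the
WEIGHTED flip `Σ_S ω(g)·F(g) = 0` for a residue-constant weight `F`, and the mixed multiplicative–additive character sums of the boundary keys `(m, L, m)`, `(L, m, m)`.  2026-09-04.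
-/
import Summits.HodgeConjecture.HodgeConjecture.Theorems.F0P3cDyRamAdmissibleShiftedCharacterSums      -- ★ p862049 (this seat, FILE 4b): `repr_admissible_image_div`, `v_div_admissible`; brings ★ κH (B1a), ★ toolkit
import Summits.HodgeConjecture.HodgeConjecture.Theorems.F0P3cDyRamAdmissibleAdditiveCharacterSum      -- ★ p862050 (this seat, FILE 4b′): `normSign_one_add_mul_eq_of_near`, `sum_normSign_one_add_mul_eq_of_repr_admissible`
import HarnessLib

/-!
# Crux `H413`, line LH4 «(D-RAM) FOUR-FRAME» — (β) table, β-BOARD row R8 ∕ (P5), FILE 4e: «THE WEIGHTED FLIP `Σ_S ω(g)·F(g) = 0` AND THE MIXED CHARACTER SUMS OF THE BOUNDARY KEYS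
# `(m, L, m)`, `(L, m, m)`»

Cell `hodgecm-mathlib` (D-0151), FLOOR 0, crux item H413 = `stmt-HodgeConjecture-24833`, route `HCCMUnconditional`; squad F0∕P3c∕LH4.  THEOREMS ONLY (no `def`, no instance, no
notation, no `sorry`, default heartbeats); ★-only imports; lane `--supports stmt-HodgeConjecture-24833 --as helper` (count-neutral); pays NO row, states NO law.

THE MATHEMATICS (this seat's H-ROW DERIVATION v1 e4da7f0103cc4a29 §3, keys `(m, L, m)` ∕ `(L, m, m)` at the boundary `s_g = 2d − 2`: «Slots 0, 2: 0», «Slots 1, 2: 0»).  There the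
per-lattice sign is `ε(g) = ω(e_B)·ψ(g)` resp. `ω(e_A)·ω(g)·ψ(1∕g)` with `ψ(x) = ω(1 + δx)` the break-level additive character (★ FILE 4b′), so the non-special slots need sums of a
MULTIPLICATIVE sign against a RESIDUE-CONSTANT weight:
* §1 **THE WEIGHTED FLIP** (★ toolkit §5 `sum_normSign_repr_eq_zero` with a weight): for a `U_F(2d−2)`-stable set `A` of fixed units, a complete irredundant system `S` of representatives
  of `A` modulo `𝔭^ρ` (`ρ ≥ 2d−1`) and any `F : K → ℤ` with `F g′ = F g` whenever `g, g′ ∈ A`, `|g − g′| < 1`: **`Σ_{g ∈ S} ω(g)·F(g) = 0`** — the break non-norm `c ≡ 1 (𝔭^{2d−2})` acts by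
  `g ↦ rep(c·g)`, a permutation of `S` moving each class INSIDE its residue class (so `F` is unchanged) and flipping `ω`.  Admissible wrapper `sum_normSign_mul_eq_zero_of_repr_admissible`.
* §2 the four vanishing mixed sums (`δ` fixed, `|δ| ≤ |ϖ|^{2d−2}`, `ρ ≥ 2d−1`, `S` admissible system): `Σ ω(g)ψ(g) = 0`, `Σ ω(1+g)ψ(g) = 0` (transport `g ↦ −(1+g)`), `Σ ω(g)ψ(1∕g) = 0`,
  `Σ ω(g)ω(1+g)ψ(1∕g) = Σ ω(1 + 1∕g)ψ(1∕g) = 0` (transport `g ↦ 1∕g`, ★ FILE 4b); and the special-slot sum of the key `(L, m, m)`: `Σ ψ(1∕g) = −q^{⌈ρ∕2⌉−1}(1 + ω(1−δ))` (★ FILE 4b′ §3 after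
  `g ↦ 1∕g`).
HONEST LABEL.  Count-neutral (`--supports`); the boundary H rows `(m,L,m)` ∕ `(L,m,m)` (FILEs 4f∕4g), the shallow keys, `hRest`, (T3), (β-BAL), (β), T₊ stay OPEN; `HC_CM` is proved only
modulo the 7 printed citations (2 remaining named inputs: hLiu418 = `stmt-HodgeConjecture-24832`, h413 = `stmt-HodgeConjecture-24833`) until rung 0 closes.

## References
* [Serre1979] J.-P. Serre, *Local Fields*, GTM 67 (1979), Ch. V §3 Prop. 5, Cor. 2–3 pp. 84–86; Ch. XV §2 (the conductor of the quadratic character).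
* [Kottwitz1986BaseChangeUnits] R. E. Kottwitz, *Base change for unit elements of Hecke algebras*, Compositio Math. 60 (1986), §1 pp. 240–241.
* [Rogawski1990] J. D. Rogawski, *Automorphic Representations of Unitary Groups in Three Variables*, Ann. of Math. Stud. 123 (1990), §4.10 p. 58.
-/

set_option autoImplicit false

noncomputable section

namespace Summit.HodgeConjecture.HodgeConjecture.Cruxes.H413.F0P3cDyRamAdmissibleWeightedCharacterSums

open WithZero Matrix
open Literature.NumberTheory.Automorphic.UnitaryThreeFourFrame
open Literature.NumberTheory.LocalFields.WildQuadraticDatum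
open Summit.HodgeConjecture.HodgeConjecture.Cruxes.H413.F0P3cDyRamFixedCountDiagonalModel (normSign_mul_norm)
open Summit.HodgeConjecture.HodgeConjecture.Cruxes.H413.F0P3cDyRamDiagonalKappaCoreHangingCharacterMaps (v_add_eq_one_of_lt v_sub_one_mul_lt_one repr_admissible_image_neg_one_add)
open Summit.HodgeConjecture.HodgeConjecture.Cruxes.H413.F0P3cDyRamDiagonalKappaCoreHangingClass (two_le_d_of_v_two_lt_one)
open Summit.HodgeConjecture.HodgeConjecture.Cruxes.H413.F0P3cDyRamAdmissibleShiftedCharacterSums (repr_admissible_image_div v_div_admissible v_add_admissible)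
open Summit.HodgeConjecture.HodgeConjecture.Cruxes.H413.F0P3cDyRamAdmissibleAdditiveCharacterSum (normSign_one_add_mul_eq_of_near v_one_add_mul_eq_one sum_normSign_one_add_mul_eq_of_repr_admissible)
open scoped Valued

variable {K : Type} [Field K] [Valued K ℤᵐ⁰]

/-! ## §1 The weighted flip -/

/-- **`Σ_{g ∈ S} ω(g)·F(g) = 0`** for a complete `K` with finite residue field, `|2| < 1`, `ρ ≥ 2d − 1`, a set `A` of fixed units STABLE under multiplication by `U_F(2d−2)`, a finite
`S ⊆ A` which is a complete irredundant system of representatives of `A` modulo `𝔭^ρ`, and a weight `F : K → ℤ` constant on the residue classes of `A` (`F g′ = F g` for `g, g′ ∈ A`,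
`|g − g′| < 1`): the involution `g ↦ rep(c·g)` (`c` the ★ toolkit §2 non-norm in `U_F(2d−2)`) permutes `S` inside residue classes and flips `ω`.
[cite: Serre1979, Ch. V §3 Cor. 3; Ch. XV §2] [cite: Kottwitz1986BaseChangeUnits, §1 pp. 240–241] -/
theorem sum_normSign_mul_repr_eq_zero [CompleteSpace K] [Finite 𝓀[K]] {σ : K →+* K} {ϖ : K} {d t : ℕ}
    (hD : IsRamifiedQuadraticDatum σ ϖ d t) (h2 : Valued.v (2 : K) < 1)
    {ρ : ℕ} (hρ : 2 * d - 1 ≤ ρ) {A : Set K} (hA : ∀ f ∈ A, σ f = f ∧ Valued.v f = 1)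
    (hAst : ∀ f ∈ A, ∀ a : K, σ a = a → Valued.v a = 1 → Valued.v (a - 1) ≤ exp (-(2 * ((d - 1 : ℕ) : ℤ))) → a * f ∈ A)
    (S : Finset K) (hS1 : ∀ g ∈ S, g ∈ A) (hS2 : ∀ f ∈ A, ∃ g ∈ S, Valued.v (f - g) ≤ Valued.v ϖ ^ ρ)
    (hS3 : ∀ g ∈ S, ∀ g' ∈ S, Valued.v (g - g') ≤ Valued.v ϖ ^ ρ → g = g')
    (F : K → ℤ) (hF : ∀ g ∈ A, ∀ g' ∈ A, Valued.v (g - g') < 1 → F g' = F g) :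
    ∑ g ∈ S, normSign σ g * F g = 0 := by
  classical
  have hσ := hD.1; have hvσ := hD.2.1; have hϖ := hD.2.2.1
  have hd2 := two_le_d_of_v_two_lt_one hD h2
  have hϖ1 : Valued.v ϖ < 1 := by rw [hϖ, ← exp_zero, exp_lt_exp]; norm_num
  have hpρ : Valued.v ϖ ^ ρ < 1 := pow_lt_one₀ zero_le hϖ1 (by omega)
  obtain ⟨c, hσc, hc1, hcd, hcn⟩ := exists_fixed_unit_not_norm_v_sub_one_le hD h2
  -- the representative map `φ g := rep(c·g)`
  have hrep : ∀ g ∈ S, ∃ g' ∈ S, Valued.v (c * g - g') ≤ Valued.v ϖ ^ ρ := fun g hg => hS2 (c * g) (hAst g (hS1 g hg) c hσc hc1 hcd)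
  choose! φ hφS hφ using hrep
  -- `|φ g − g| < 1`, so `F(φ g) = F(g)`; and `ω(φ g) = −ω(g)`
  have hflip : ∀ g ∈ S, normSign σ (φ g) * F (φ g) = -(normSign σ g * F g) := by
    intro g hg
    obtain ⟨hσg, hvg⟩ := hA g (hS1 g hg)
    have hg0 : g ≠ 0 := fun h0 => by rw [h0, map_zero] at hvg; exact zero_ne_one hvg
    have hσcg : σ (c * g) = c * g := by rw [map_mul, hσc, hσg]
    have hvcg : Valued.v (c * g) = 1 := by rw [map_mul, hc1, hvg, mul_one]
    have hnear : Valued.v (g - φ g) < 1 := by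
      rw [show g - φ g = (c * g - φ g) + -((c - 1) * g) by ring]
      refine (Valuation.map_add _ _ _).trans_lt (max_lt (lt_of_le_of_lt (hφ g hg) hpρ) ?_)
      rw [Valuation.map_neg]; exact v_sub_one_mul_lt_one hd2 hcd hvg
    rw [hF g (hS1 g hg) (φ g) (hS1 _ (hφS g hg)) hnear,
      normSign_eq_of_near hD hσcg (hA _ (hS1 _ (hφS g hg))).1 hvcg hρ (hφ g hg), normSign_mul_eq_neg_of_not_norm hD hσc hcn hσg hg0, neg_mul]
  -- `φ` maps `S` to `S` injectively, hence bijectively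
  have hinj : ∀ g₁ ∈ S, ∀ g₂ ∈ S, φ g₁ = φ g₂ → g₁ = g₂ := by
    intro g₁ hg₁ g₂ hg₂ heq
    have hc0 : c ≠ 0 := fun h0 => by rw [h0, map_zero] at hc1; exact zero_ne_one hc1
    apply hS3 g₁ hg₁ g₂ hg₂
    have h1 := hφ g₁ hg₁; have h2' := hφ g₂ hg₂
    rw [heq] at h1
    have e : g₁ - g₂ = c⁻¹ * ((c * g₁ - φ g₂) - (c * g₂ - φ g₂)) := by field_simp; ring
    rw [e, map_mul, map_inv₀, hc1, inv_one, one_mul]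
    exact (Valuation.map_sub _ _ _).trans (max_le h1 h2')
  have hsum : ∑ g ∈ S, normSign σ (φ g) * F (φ g) = ∑ g ∈ S, normSign σ g * F g :=
    Finset.sum_bij (fun g _ => φ g) (fun g hg => hφS g hg) (fun g₁ hg₁ g₂ hg₂ h => hinj g₁ hg₁ g₂ hg₂ h)
      (fun g' hg' => by
        have himg : (S.image φ) = S := Finset.eq_of_subset_of_card_le (Finset.image_subset_iff.2 fun g hg => hφS g hg)
          (by rw [Finset.card_image_of_injOn (fun g₁ hg₁ g₂ hg₂ h => hinj g₁ hg₁ g₂ hg₂ h)])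
        have hg'' : g' ∈ S.image φ := by rw [himg]; exact hg'
        obtain ⟨g, hg, hgg'⟩ := Finset.mem_image.1 hg''
        exact ⟨g, hg, hgg'⟩)
      (fun _ _ => rfl)
  have hneg : ∑ g ∈ S, normSign σ (φ g) * F (φ g) = -∑ g ∈ S, normSign σ g * F g := by
    rw [← Finset.sum_neg_distrib]; exact Finset.sum_congr rfl hflip
  have h2' : (2 : ℤ) * ∑ g ∈ S, normSign σ g * F g = 0 := by linarith
  simpa using h2'

/-- **`Σ_S ω(g)·F(g) = 0` over a complete irredundant system `S` of representatives modulo `𝔭^ρ` (`ρ ≥ 2d−1`) of the ADMISSIBLE fixed units `{|g| = |1+g| = 1}`**, `F` constant on the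
residue classes of the admissible units (§1; the admissible set is `U_F(2d−2)`-stable, ★ κH (B1a) §2). [cite: Serre1979, Ch. V §3 Cor. 3; Ch. XV §2] [cite: Kottwitz1986BaseChangeUnits, §1 pp. 240–241] -/
theorem sum_normSign_mul_eq_zero_of_repr_admissible [CompleteSpace K] [Finite 𝓀[K]] {σ : K →+* K} {ϖ : K} {d t : ℕ}
    (hD : IsRamifiedQuadraticDatum σ ϖ d t) (h2 : Valued.v (2 : K) < 1) {ρ : ℕ} (hρ : 2 * d - 1 ≤ ρ) (S : Finset K)
    (hS1 : ∀ g ∈ S, σ g = g ∧ Valued.v g = 1 ∧ Valued.v (1 + g) = 1)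
    (hS2 : ∀ f : K, σ f = f → Valued.v f = 1 → Valued.v (1 + f) = 1 → ∃ g ∈ S, Valued.v (f - g) ≤ Valued.v ϖ ^ ρ)
    (hS3 : ∀ g ∈ S, ∀ g' ∈ S, Valued.v (g - g') ≤ Valued.v ϖ ^ ρ → g = g')
    (F : K → ℤ) (hF : ∀ g g' : K, σ g = g → Valued.v g = 1 → σ g' = g' → Valued.v g' = 1 → Valued.v (g - g') < 1 → F g' = F g) :
    ∑ g ∈ S, normSign σ g * F g = 0 := by
  have hd2 := two_le_d_of_v_two_lt_one hD h2
  refine sum_normSign_mul_repr_eq_zero hD h2 hρ (A := {f : K | σ f = f ∧ Valued.v f = 1 ∧ Valued.v (1 + f) = 1})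
    (fun f hf => ⟨hf.1, hf.2.1⟩) ?_ S (fun g hg => hS1 g hg) (fun f hf => hS2 f hf.1 hf.2.1 hf.2.2) hS3 F
    (fun g hg g' hg' h => hF g g' hg.1 hg.2.1 hg'.1 hg'.2.1 h)
  rintro f ⟨hσf, hf, h1f⟩ a hσa ha ha1
  refine ⟨by rw [map_mul, hσa, hσf], by rw [map_mul, ha, hf, one_mul], ?_⟩
  rw [show 1 + a * f = (1 + f) + (a - 1) * f by ring]
  exact v_add_eq_one_of_lt h1f (v_sub_one_mul_lt_one hd2 ha1 hf)

/-! ## §2 The mixed sums of the boundary keys `(m, L, m)`, `(L, m, m)` -/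

section Mixed

variable [CompleteSpace K] [Finite 𝓀[K]] {σ : K →+* K} {ϖ : K} {d t : ℕ}

/-- **`Σ_S ω(g)·ω(1 + δg) = 0`** (`S` admissible system, `ρ ≥ 2d−1`, `δ` fixed with `|δ| ≤ |ϖ|^{2d−2}`): §1 with the residue-constant weight `ψ(g) = ω(1 + δg)` (★ FILE 4b′).  Key `(m, L, m)`,
slot 0. [cite: Serre1979, Ch. XV §2] [cite: Kottwitz1986BaseChangeUnits, §1 pp. 240–241] -/
theorem sum_normSign_mul_psi_eq_zero (hD : IsRamifiedQuadraticDatum σ ϖ d t) (h2 : Valued.v (2 : K) < 1) {ρ : ℕ} (hρ : 2 * d - 1 ≤ ρ)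
    {δ : K} (hσδ : σ δ = δ) (hδ : Valued.v δ ≤ Valued.v ϖ ^ (2 * d - 2)) (S : Finset K)
    (hS1 : ∀ g ∈ S, σ g = g ∧ Valued.v g = 1 ∧ Valued.v (1 + g) = 1)
    (hS2 : ∀ f : K, σ f = f → Valued.v f = 1 → Valued.v (1 + f) = 1 → ∃ g ∈ S, Valued.v (f - g) ≤ Valued.v ϖ ^ ρ)
    (hS3 : ∀ g ∈ S, ∀ g' ∈ S, Valued.v (g - g') ≤ Valued.v ϖ ^ ρ → g = g') :
    ∑ g ∈ S, normSign σ g * normSign σ (1 + δ * g) = 0 :=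
  sum_normSign_mul_eq_zero_of_repr_admissible hD h2 hρ S hS1 hS2 hS3 (fun g => normSign σ (1 + δ * g))
    (fun _ _ hσg hvg hσg' _ h => normSign_one_add_mul_eq_of_near hD h2 hσδ hδ hσg hσg' hvg.le h)

/-- **`Σ_S ω(1 + g)·ω(1 + δg) = 0`** (same hypotheses): along `h = −(1+g)` (★ κH (B1a) transport) the summand is `ω(−1)·ω(h)·ψ(−1 − h)`, and `h ↦ ψ(−1 − h)` is residue-constant (§1).
Key `(m, L, m)`, slot 2. [cite: Serre1979, Ch. XV §2] [cite: Kottwitz1986BaseChangeUnits, §1 pp. 240–241] -/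
theorem sum_normSign_one_add_mul_psi_eq_zero (hD : IsRamifiedQuadraticDatum σ ϖ d t) (h2 : Valued.v (2 : K) < 1) {ρ : ℕ} (hρ : 2 * d - 1 ≤ ρ)
    {δ : K} (hσδ : σ δ = δ) (hδ : Valued.v δ ≤ Valued.v ϖ ^ (2 * d - 2)) (S : Finset K)
    (hS1 : ∀ g ∈ S, σ g = g ∧ Valued.v g = 1 ∧ Valued.v (1 + g) = 1)
    (hS2 : ∀ f : K, σ f = f → Valued.v f = 1 → Valued.v (1 + f) = 1 → ∃ g ∈ S, Valued.v (f - g) ≤ Valued.v ϖ ^ ρ)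
    (hS3 : ∀ g ∈ S, ∀ g' ∈ S, Valued.v (g - g') ≤ Valued.v ϖ ^ ρ → g = g') :
    ∑ g ∈ S, normSign σ (1 + g) * normSign σ (1 + δ * g) = 0 := by
  classical
  -- `ω(1+g) = ω(−1)·ω(−(1+g))` and `g = −1 − h` with `h = −(1+g)`
  have hterm : ∀ g ∈ S, normSign σ (1 + g) * normSign σ (1 + δ * g) =
      normSign σ (-1 : K) * (normSign σ (-(1 + g)) * normSign σ (1 + δ * (-1 - -(1 + g)))) := by
    intro g hg
    obtain ⟨hσg, -, h1g⟩ := hS1 g hg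
    have h1g0 : 1 + g ≠ 0 := fun h => by rw [h, map_zero] at h1g; exact zero_ne_one h1g
    rw [show (-1 : K) - -(1 + g) = g by ring, ← mul_assoc,
      ← normSign_mul_of_fixed hD (by rw [map_neg, map_one]) (by rw [map_neg, map_add, map_one, hσg]) (neg_ne_zero.2 one_ne_zero) (neg_ne_zero.2 h1g0),
      show (-1 : K) * -(1 + g) = 1 + g by ring]
  rw [Finset.sum_congr rfl hterm, ← Finset.mul_sum]
  obtain ⟨h1, h2', h3⟩ := repr_admissible_image_neg_one_add S hS1 hS2 hS3
  have hinj : Set.InjOn (fun g : K => -(1 + g)) ↑S := fun g _ g' _ h => by simpa using h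
  have hsi : ∑ h ∈ S.image (fun g => -(1 + g)), normSign σ h * normSign σ (1 + δ * (-1 - h)) =
      ∑ g ∈ S, normSign σ (-(1 + g)) * normSign σ (1 + δ * (-1 - -(1 + g))) := Finset.sum_image hinj
  rw [← hsi, sum_normSign_mul_eq_zero_of_repr_admissible hD h2 hρ _ h1 h2' h3 (fun h => normSign σ (1 + δ * (-1 - h))) ?_, mul_zero]
  intro g g' hσg hvg hσg' _ h
  exact normSign_one_add_mul_eq_of_near hD h2 hσδ hδ (x := -1 - g) (x' := -1 - g') (by rw [map_sub, map_neg, map_one, hσg]) (by rw [map_sub, map_neg, map_one, hσg'])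
    ((Valuation.map_sub _ _ _).trans (max_le (by rw [Valuation.map_neg, map_one]) hvg.le))
    (by rw [show (-1 : K) - g - (-1 - g') = -(g - g') by ring, Valuation.map_neg]; exact h)

/-- **`Σ_S ω(g)·ω(1 + δ∕g) = 0`** (same hypotheses): `g ↦ ψ(1∕g)` is residue-constant on the admissible units (`|1∕g − 1∕g′| = |g − g′|`), §1.  Key `(L, m, m)`, slot 1.
[cite: Serre1979, Ch. XV §2] [cite: Kottwitz1986BaseChangeUnits, §1 pp. 240–241] -/
theorem sum_normSign_mul_psi_inv_eq_zero (hD : IsRamifiedQuadraticDatum σ ϖ d t) (h2 : Valued.v (2 : K) < 1) {ρ : ℕ} (hρ : 2 * d - 1 ≤ ρ)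
    {δ : K} (hσδ : σ δ = δ) (hδ : Valued.v δ ≤ Valued.v ϖ ^ (2 * d - 2)) (S : Finset K)
    (hS1 : ∀ g ∈ S, σ g = g ∧ Valued.v g = 1 ∧ Valued.v (1 + g) = 1)
    (hS2 : ∀ f : K, σ f = f → Valued.v f = 1 → Valued.v (1 + f) = 1 → ∃ g ∈ S, Valued.v (f - g) ≤ Valued.v ϖ ^ ρ)
    (hS3 : ∀ g ∈ S, ∀ g' ∈ S, Valued.v (g - g') ≤ Valued.v ϖ ^ ρ → g = g') :
    ∑ g ∈ S, normSign σ g * normSign σ (1 + δ * g⁻¹) = 0 := by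
  refine sum_normSign_mul_eq_zero_of_repr_admissible hD h2 hρ S hS1 hS2 hS3 (fun g => normSign σ (1 + δ * g⁻¹)) ?_
  intro g g' hσg hvg hσg' hvg' h
  have hg0 : g ≠ 0 := fun h0 => by rw [h0, map_zero] at hvg; exact zero_ne_one hvg
  have hg'0 : g' ≠ 0 := fun h0 => by rw [h0, map_zero] at hvg'; exact zero_ne_one hvg'
  refine normSign_one_add_mul_eq_of_near hD h2 hσδ hδ (by rw [map_inv₀, hσg]) (by rw [map_inv₀, hσg']) (by rw [map_inv₀, hvg, inv_one]) ?_
  rw [show g⁻¹ - g'⁻¹ = -((g - g') / (g * g')) by field_simp; ring, Valuation.map_neg, map_div₀, map_mul, hvg, hvg', mul_one, div_one]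
  exact h

/-- **`Σ_S ω(g)·ω(1 + g)·ω(1 + δ∕g) = 0`** (same hypotheses): `ω(g)ω(1+g) = ω(1 + 1∕g)` (`g(1+g) = g²(1 + 1∕g)`), then along `h = 1∕g` (★ FILE 4b transport with `c = 1`) the sum is the
previous lemma's `Σ ω(1+h)ψ(h) = 0`.  Key `(L, m, m)`, slot 2. [cite: Serre1979, Ch. XV §2] [cite: Kottwitz1986BaseChangeUnits, §1 pp. 240–241] -/
theorem sum_normSign_mul_normSign_one_add_mul_psi_inv_eq_zero (hD : IsRamifiedQuadraticDatum σ ϖ d t) (h2 : Valued.v (2 : K) < 1) {ρ : ℕ} (hρ : 2 * d - 1 ≤ ρ)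
    {δ : K} (hσδ : σ δ = δ) (hδ : Valued.v δ ≤ Valued.v ϖ ^ (2 * d - 2)) (S : Finset K)
    (hS1 : ∀ g ∈ S, σ g = g ∧ Valued.v g = 1 ∧ Valued.v (1 + g) = 1)
    (hS2 : ∀ f : K, σ f = f → Valued.v f = 1 → Valued.v (1 + f) = 1 → ∃ g ∈ S, Valued.v (f - g) ≤ Valued.v ϖ ^ ρ)
    (hS3 : ∀ g ∈ S, ∀ g' ∈ S, Valued.v (g - g') ≤ Valued.v ϖ ^ ρ → g = g') :
    ∑ g ∈ S, normSign σ g * normSign σ (1 + g) * normSign σ (1 + δ * g⁻¹) = 0 := by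
  classical
  have hterm : ∀ g ∈ S, normSign σ g * normSign σ (1 + g) * normSign σ (1 + δ * g⁻¹) = normSign σ (1 + 1 / g) * normSign σ (1 + δ * (1 / g)) := by
    intro g hg
    obtain ⟨hσg, hvg, h1g⟩ := hS1 g hg
    have hg0 : g ≠ 0 := fun h => by rw [h, map_zero] at hvg; exact zero_ne_one hvg
    have h1g0 : 1 + g ≠ 0 := fun h => by rw [h, map_zero] at h1g; exact zero_ne_one h1g
    rw [one_div, ← normSign_mul_of_fixed hD hσg (by rw [map_add, map_one, hσg]) hg0 h1g0,
      show g * (1 + g) = (1 + g⁻¹) * (g * σ g) by rw [hσg]; field_simp; ring, normSign_mul_norm σ _ hg0]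
  rw [Finset.sum_congr rfl hterm]
  obtain ⟨h1, h2', h3⟩ := repr_admissible_image_div h2 (map_one σ) (by rw [sub_self, map_zero]; exact zero_lt_one) S hS1 hS2 hS3
  have hinj : Set.InjOn (fun g : K => 1 / g) ↑S := fun g _ g' _ h => by simpa using h
  have hsi : ∑ h ∈ S.image (fun g => 1 / g), normSign σ (1 + h) * normSign σ (1 + δ * h) =
      ∑ g ∈ S, normSign σ (1 + 1 / g) * normSign σ (1 + δ * (1 / g)) := Finset.sum_image hinj
  rw [← hsi]
  exact sum_normSign_one_add_mul_psi_eq_zero hD h2 hρ hσδ hδ _ h1 h2' h3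

/-- **`Σ_S ω(1 + δ∕g) = −q^{⌈ρ∕2⌉−1}·(1 + ω(1 − δ))`** (`S` admissible system, `ρ ≥ 1`, `|δ| = |ϖ|^{2d−2}`): ★ FILE 4b′ §3 along `h = 1∕g` (★ FILE 4b transport with `c = 1`).  Key `(L, m, m)`,
slot 0 (the special slot). [cite: Serre1979, Ch. XV §2; Ch. IV §2 Prop. 6] [cite: Kottwitz1986BaseChangeUnits, §1 pp. 240–241] -/
theorem sum_psi_inv_eq_of_repr_admissible (hD : IsRamifiedQuadraticDatum σ ϖ d t) (h2 : Valued.v (2 : K) < 1) {ρ : ℕ} (hρ : 1 ≤ ρ)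
    {δ : K} (hσδ : σ δ = δ) (hδ : Valued.v δ = Valued.v ϖ ^ (2 * d - 2)) (S : Finset K)
    (hS1 : ∀ g ∈ S, σ g = g ∧ Valued.v g = 1 ∧ Valued.v (1 + g) = 1)
    (hS2 : ∀ f : K, σ f = f → Valued.v f = 1 → Valued.v (1 + f) = 1 → ∃ g ∈ S, Valued.v (f - g) ≤ Valued.v ϖ ^ ρ)
    (hS3 : ∀ g ∈ S, ∀ g' ∈ S, Valued.v (g - g') ≤ Valued.v ϖ ^ ρ → g = g') :
    ∑ g ∈ S, normSign σ (1 + δ * g⁻¹) = -((Nat.card 𝓀[K] : ℤ) ^ ((ρ + 1) / 2 - 1)) * (1 + normSign σ (1 - δ)) := by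
  classical
  obtain ⟨h1, h2', h3⟩ := repr_admissible_image_div h2 (map_one σ) (by rw [sub_self, map_zero]; exact zero_lt_one) S hS1 hS2 hS3
  have hinj : Set.InjOn (fun g : K => 1 / g) ↑S := fun g _ g' _ h => by simpa using h
  have hsi : ∑ h ∈ S.image (fun g => 1 / g), normSign σ (1 + δ * h) = ∑ g ∈ S, normSign σ (1 + δ * (1 / g)) := Finset.sum_image hinj
  rw [Finset.sum_congr rfl fun g _ => by rw [← one_div], ← hsi]
  exact sum_normSign_one_add_mul_eq_of_repr_admissible hD h2 hρ hσδ hδ _ h1 h2' h3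

end Mixed

end Summit.HodgeConjecture.HodgeConjecture.Cruxes.H413.F0P3cDyRamAdmissibleWeightedCharacterSums

end
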